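import Mathlib
import Summits.Ventures.HodgeRepro2.A1EigenlinePermutation
import Summits.Ventures.HodgeRepro2.A1GaloisTensorSplitting

/-!
# The eigenline decomposition `L ⊗[K] V = ⊕_σ V_σ` over a splitting field `L`

Blind cell `pub-hodge-repro2`, seat p7 (gen 10), A1 annex (route/T4-A1-p7.md, (A0.4) / Lemma
A1.3; route/LEAN-ANNEX-p7.md §4).  `A1EigenlineDecomposition` (p393199) proved «`H¹(A, ℂ) = ⊕_σ
ℓ_σ`» for an abstract `(ℂ ⊗[ℚ] F)`-module.  This file proves the decomposition for the CONCRETE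
module `L ⊗[K] V` (`V` a `K`-space with an `F`-action, the `H¹(B, ℚ)` of A1) over ANY field
`L ⊇ K` receiving all `[F : K]` embeddings of `F` — in particular over `L = F` when `F/K` is
Galois (`A1GaloisTensorSplitting.card_algHom_self`), which is the field the descent
(`A1SplitSummandDescent`) works over.  The eigenlines are those of `A1EigenlinePermutation`.

* `ρ : L ⊗[K] F →ₐ[L] Module.End L (L ⊗[K] V)`, `c ⊗ x ↦ c • actF x` (the action of the split
  algebra `L ⊗[K] F ≃ ∏_σ L` on `L ⊗[K] V`);
* `ρ_apply_of_mem_eigenline`: on the `σ`-eigenline, `t` acts as the scalar `tensorEquiv t σ`;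
* `idem σ := tensorEquiv⁻¹ (Pi.single σ 1)`: the orthogonal idempotents of the split algebra;
  `ρ (idem σ)` is the projector onto the `σ`-eigenline (`ρ_idem_mem_eigenline`,
  `ρ_idem_apply_of_mem_eigenline`, `sum_idem`);
* **`isInternal_eigenline`**: `DirectSum.IsInternal (eigenline L V)` — `L ⊗[K] V = ⊕_σ V_σ`;
* `eigenline_eq_range`: `V_σ` is the range of the projector `ρ (idem σ)`.

What stays prose (A1 §4): the identification `V = H¹(B, ℚ)` (geometry); `dim_L V_σ = dim_F V`
is not in this file.

README §8(d): uses an L-value-free non-vanishing device: NO.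
-/

namespace Summit.Ventures.HodgeRepro2.A1EigenlineDecompositionGalois

open TensorProduct
open Summit.Ventures.HodgeRepro2.A1EigenlinePermutation
open Summit.Ventures.HodgeRepro2.A1GaloisTensorSplitting

section Action

variable (K L : Type*) [Field K] [Field L] [Algebra K L]
variable (F : Type*) [Field F] [Algebra K F]
variable (V : Type*) [AddCommGroup V] [Module K V] [Module F V] [IsScalarTower K F V]

/-- The `F`-action on `L ⊗[K] V` through the right factor, as a `K`-algebra map
`F → End_L (L ⊗[K] V)` (Mathlib's `Module.End.baseChangeHom` of `Algebra.lsmul`). -/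
noncomputable def actFAlg : F →ₐ[K] Module.End L (L ⊗[K] V) :=
  (Module.End.baseChangeHom K L V).comp (Algebra.lsmul K K V)

/-- `actFAlg x = actF L x` (as `L`-linear maps). -/
theorem actFAlg_apply (x : F) : actFAlg K L F V x = actF L x := by
  change LinearMap.baseChange L (Algebra.lsmul K K V x) = actF L x
  apply LinearMap.ext
  intro m
  induction m using TensorProduct.induction_on with
  | zero => simp
  | tmul c v => rw [LinearMap.baseChange_tmul, actF_tmul, Algebra.lsmul_coe]
  | add a b ha hb => simp only [map_add, ha, hb]

/-- The action of the split algebra `L ⊗[K] F` on `L ⊗[K] V`: `c ⊗ x ↦ c • actF x`, an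
`L`-algebra map into `End_L (L ⊗[K] V)`. -/
noncomputable def ρ : L ⊗[K] F →ₐ[L] Module.End L (L ⊗[K] V) :=
  Algebra.TensorProduct.lift (Algebra.ofId L _) (actFAlg K L F V)
    (fun c x => by
      rw [Algebra.ofId_apply]
      exact Algebra.commutes c _)

/-- `ρ (c ⊗ x) = c • actF x`. -/
theorem ρ_tmul (c : L) (x : F) : ρ K L F V (c ⊗ₜ[K] x) = c • actF L x := by
  rw [ρ, Algebra.TensorProduct.lift_tmul, actFAlg_apply, Algebra.ofId_apply,
    Algebra.algebraMap_eq_smul_one, smul_mul_assoc, one_mul]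

/-- `ρ (c ⊗ x) m = c • actF x m`. -/
theorem ρ_tmul_apply (c : L) (x : F) (m : L ⊗[K] V) :
    ρ K L F V (c ⊗ₜ[K] x) m = c • actF L x m := by
  rw [ρ_tmul, LinearMap.smul_apply]

/-- `ρ (1 ⊗ x) = actF x`. -/
theorem ρ_one_tmul (x : F) : ρ K L F V ((1 : L) ⊗ₜ[K] x) = actF L x := by
  rw [ρ_tmul, one_smul]

/-- **Eigenvalue of the split algebra on an eigenline.** For `m ∈ V_σ` every `t ∈ L ⊗[K] F` acts
as the scalar `tensorEquiv t σ` (the `σ`-th coordinate of `t` in `∏_σ L`). -/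
theorem ρ_apply_of_mem_eigenline [FiniteDimensional K F] [Fintype (Emb K L F)]
    (hcard : Fintype.card (Emb K L F) = Module.finrank K F) (t : L ⊗[K] F) (σ : Emb K L F)
    {m : L ⊗[K] V} (hm : m ∈ eigenline L V σ) :
    ρ K L F V t m = tensorEquiv K L F hcard t σ • m := by
  rw [mem_eigenline_iff] at hm
  induction t using TensorProduct.induction_on with
  | zero => simp
  | tmul c x => rw [ρ_tmul_apply, hm x, tensorEquiv_tmul, smul_smul]
  | add a b ha hb => rw [map_add, LinearMap.add_apply, ha, hb, map_add, Pi.add_apply, add_smul]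

end Action

section Decomposition

variable (K L : Type*) [Field K] [Field L] [Algebra K L]
variable (F : Type*) [Field F] [Algebra K F] [FiniteDimensional K F]
variable (V : Type*) [AddCommGroup V] [Module K V] [Module F V] [IsScalarTower K F V]
variable [Fintype (Emb K L F)] [DecidableEq (Emb K L F)]
  (hcard : Fintype.card (Emb K L F) = Module.finrank K F)

/-- The orthogonal idempotent of the split algebra `L ⊗[K] F ≃ ∏_σ L` at the embedding `σ`
(the preimage of `Pi.single σ 1`). -/
noncomputable def idem (σ : Emb K L F) : L ⊗[K] F :=
  (tensorEquiv K L F hcard).symm (Pi.single σ 1)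

/-- `tensorEquiv (idem σ) = Pi.single σ 1`. -/
@[simp] theorem tensorEquiv_idem (σ : Emb K L F) :
    tensorEquiv K L F hcard (idem K L F hcard σ) = Pi.single σ 1 :=
  (tensorEquiv K L F hcard).apply_symm_apply _

/-- `(1 ⊗ x) · idem σ = σ x • idem σ`. -/
theorem one_tmul_mul_idem (σ : Emb K L F) (x : F) :
    ((1 : L) ⊗ₜ[K] x) * idem K L F hcard σ = σ x • idem K L F hcard σ := by
  apply (tensorEquiv K L F hcard).injective
  rw [map_mul, map_smul, tensorEquiv_idem, tensorEquiv_tmul]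
  ext τ
  simp only [Pi.mul_apply, Pi.smul_apply, Pi.single_apply, smul_eq_mul]
  split_ifs with h
  · subst h
    ring
  · simp

/-- `∑_σ idem σ = 1`. -/
theorem sum_idem : ∑ σ, idem K L F hcard σ = 1 := by
  apply (tensorEquiv K L F hcard).injective
  rw [map_sum, map_one]
  simp only [tensorEquiv_idem]
  ext τ
  rw [Finset.sum_apply, Finset.sum_pi_single, if_pos (Finset.mem_univ _)]
  rfl

/-- **The projector onto the `σ`-eigenline.** `ρ (idem σ) m` lies in `V_σ` for every `m`. -/
theorem ρ_idem_mem_eigenline (σ : Emb K L F) (m : L ⊗[K] V) :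
    ρ K L F V (idem K L F hcard σ) m ∈ eigenline L V σ := by
  rw [mem_eigenline_iff]
  intro x
  rw [← ρ_one_tmul K L F V x, ← Module.End.mul_apply, ← map_mul, one_tmul_mul_idem, map_smul,
    LinearMap.smul_apply]

/-- On `V_τ`, `ρ (idem σ)` is the identity for `τ = σ` and zero otherwise. -/
theorem ρ_idem_apply_of_mem_eigenline (σ τ : Emb K L F) {m : L ⊗[K] V}
    (hm : m ∈ eigenline L V τ) :
    ρ K L F V (idem K L F hcard σ) m = if τ = σ then m else 0 := by
  rw [ρ_apply_of_mem_eigenline K L F V hcard _ τ hm, tensorEquiv_idem, Pi.single_apply]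
  split_ifs <;> simp

/-- Every `m` is the sum of its eigen-components: `m = ∑_σ ρ (idem σ) m`. -/
theorem eq_sum_ρ_idem (m : L ⊗[K] V) : m = ∑ σ, ρ K L F V (idem K L F hcard σ) m := by
  rw [← LinearMap.sum_apply, ← map_sum, sum_idem, map_one, Module.End.one_apply]

/-- The eigenlines span: `⨆_σ V_σ = ⊤`. -/
theorem iSup_eigenline_eq_top (hcard : Fintype.card (Emb K L F) = Module.finrank K F) :
    ⨆ σ : Emb K L F, eigenline L V σ = ⊤ := by
  rw [eq_top_iff]
  intro m _
  rw [eq_sum_ρ_idem K L F V hcard m]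
  exact Submodule.sum_mem _ fun σ _ =>
    Submodule.mem_iSup_of_mem σ (ρ_idem_mem_eigenline K L F V hcard σ m)

/-- `ρ (idem σ)` kills every `V_τ`, `τ ≠ σ`, hence their sum. -/
theorem ρ_idem_apply_eq_zero_of_mem_iSup (σ : Emb K L F) {m : L ⊗[K] V}
    (hm : m ∈ ⨆ τ, ⨆ (_ : τ ≠ σ), eigenline L V τ) :
    ρ K L F V (idem K L F hcard σ) m = 0 := by
  refine Submodule.iSup_induction _ (motive := fun m => ρ K L F V (idem K L F hcard σ) m = 0)
    hm ?_ (by simp) ?_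
  · intro τ m hm
    refine Submodule.iSup_induction _ (motive := fun m => ρ K L F V (idem K L F hcard σ) m = 0)
      hm ?_ (by simp) ?_
    · intro hτ m hm
      rw [ρ_idem_apply_of_mem_eigenline K L F V hcard σ τ hm, if_neg hτ]
    · intro x y hx hy
      rw [map_add, hx, hy, add_zero]
  · intro x y hx hy
    rw [map_add, hx, hy, add_zero]

/-- The eigenlines are independent. -/
theorem iSupIndep_eigenline (hcard : Fintype.card (Emb K L F) = Module.finrank K F) :
    iSupIndep (fun σ : Emb K L F => eigenline L V σ) := by
  rw [iSupIndep_def]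
  intro σ
  rw [Submodule.disjoint_def]
  intro m hm hm'
  have h1 := ρ_idem_apply_of_mem_eigenline K L F V hcard σ σ hm
  rw [if_pos rfl] at h1
  rw [← h1]
  exact ρ_idem_apply_eq_zero_of_mem_iSup K L F V hcard σ hm'

/-- **The eigenline decomposition** `L ⊗[K] V = ⊕_σ V_σ` (Lemma A1.3 / (A0.4) over a splitting
field `L`; for `F/K` Galois take `L = F` with `card_algHom_self`). -/
theorem isInternal_eigenline (hcard : Fintype.card (Emb K L F) = Module.finrank K F) :
    DirectSum.IsInternal (fun σ : Emb K L F => eigenline L V σ) :=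
  DirectSum.isInternal_submodule_of_iSupIndep_of_iSup_eq_top (iSupIndep_eigenline K L F V hcard)
    (iSup_eigenline_eq_top K L F V hcard)

/-- `V_σ` is the range of the projector `ρ (idem σ)`. -/
theorem eigenline_eq_range (σ : Emb K L F) :
    eigenline L V σ = LinearMap.range (ρ K L F V (idem K L F hcard σ)) := by
  apply le_antisymm
  · intro m hm
    refine ⟨m, ?_⟩
    rw [ρ_idem_apply_of_mem_eigenline K L F V hcard σ σ hm, if_pos rfl]
  · rintro _ ⟨m, rfl⟩
    exact ρ_idem_mem_eigenline K L F V hcard σ m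

end Decomposition

section GaloisSelf

variable (K F : Type*) [Field K] [Field F] [Algebra K F] [FiniteDimensional K F] [IsGalois K F]
variable (V : Type*) [AddCommGroup V] [Module K V] [Module F V] [IsScalarTower K F V]

/-- **Over the Galois field itself**: `F ⊗[K] V = ⊕_{σ : F → F} V_σ` for `F/K` finite Galois. -/
theorem isInternal_eigenline_self [DecidableEq (Emb K F F)] :
    DirectSum.IsInternal (fun σ : Emb K F F => eigenline F V σ) :=
  isInternal_eigenline K F F V (card_algHom_self K F)

end GaloisSelf

end Summit.Ventures.HodgeRepro2.A1EigenlineDecompositionGalois
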